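import Summits.CriticalPhenomena.PercolationContinuityZ3.Theorems.PercNearOneGluingAdditiveGluingSandwichLemmaU
import Literature.Probability.Percolation.TwoClusterConditionalAssociationProofs
import HarnessLib

/-!
# Sandwich BHK for a SET observer — I: conditioning on a cluster, Lemma U for an observer set

Crux `PercNearOneGluing.AdditiveGluing` (stmt-CriticalPhenomena-4576), stub `stub_goodStep` (stub-plan prover;
STUB-PLAN-stub_goodStep.md §2/§4: the kernel `stub_blockGoodTwo` at `A.card = 3` is designated goodness of a BLOCK
observer — the two-relay drift theorem — and follows from Kozma–Nitzan's Lemma 3 for sandwich events of the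
cluster `K_O = ⋃_{o ∈ O} C(o)` of an observer SET `O`, as seat k41 derived the point case from its Theorem S).
First file of the set-observer version of k41's `…SandwichLemmaU/CoreS/Lemma3.lean`; `--supports` the crux;
no definitions.  Notation (finite-sum framework of `ConditionalPositiveAssociationProofs.lean`): `weight w ω`,
`C_s = openEdgeCluster ω s`, `W̄ = {e | ∃ v ∈ e, v = s ∨ ∃ e' ∈ W, v ∈ e'}`, `K_O = ⋃_{o ∈ O} C_o`, `s ↔ O` = `∃ o ∈ O, s ↔ o`.
* `sum_cond_cluster_gen`: `E[Ψ(C_s, ω ∖ C̄_s)] = E_ω[E_η[Ψ(C_s(ω), η ∖ C̄_s(ω))]]` for ANY `Ψ` (block Fubini).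
* `lemmaU_set`: for `F` increasing and `h ≤ 1`, `E[F(C_s)] · E[g₀] ≤ E[F(C_s) g₀]`, `g₀ = 1{s ↔ O} + 1{s ↮ O} h(K_O)`;
  strong induction on `O`: condition on `C_{o₁}`; on `{C_{o₁} = W, s ∉ V̄(W)}` the integrand is the same functional
  for `{o ∈ O | o ∉ V̄(W)}` in the model with the pairs of `W̄` switched off (induction hypothesis + domination).
[cite: VandenbergHaggstromKahn2005, §1 p. 8 (conditioning on `C_s = W`, coupling)]
-/


noncomputable section

open MeasureTheory unitInterval
open Literature.Probability.LatticeModels (prodBernoulli)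
open Literature.Probability.Percolation
open Literature.Probability.Percolation.BHK2006

namespace Summit.CriticalPhenomena.PercolationContinuityZ3.Theorems

namespace SandwichSet

open scoped Classical
open DecisionTree (ind ind_of_mem ind_of_not_mem ind_nonneg)
open SandwichK41

variable {V : Type*}
section Graph

/-- Vertices in the same open component have the same open edge cluster. [folklore] -/
theorem openEdgeCluster_eq_of_reachable {ω : Set (Sym2 V)} {a c : V}
    (h : (openGraph ω).Reachable a c) : openEdgeCluster ω c = openEdgeCluster ω a := by
  ext e
  simp only [mem_openEdgeCluster_iff]
  exact ⟨fun ⟨he, hd, hr⟩ => ⟨he, hd, fun v hv => h.trans (hr v hv)⟩,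
    fun ⟨he, hd, hr⟩ => ⟨he, hd, fun v hv => h.symm.trans (hr v hv)⟩⟩

/-- `v ∈ V̄(W)` (`v = o₁` or `v` on an edge of `W = C_{o₁}`) iff `o₁ ↔ v`. [cite: VandenbergHaggstromKahn2005, §1 p. 3] -/
theorem mem_bar_iff_reachable {ω W : Set (Sym2 V)} {o₁ : V} (hW : openEdgeCluster ω o₁ = W) (v : V) :
    (v = o₁ ∨ ∃ e ∈ W, v ∈ e) ↔ (openGraph ω).Reachable o₁ v := by
  rw [reachable_iff_exists_mem_openEdgeCluster, hW]

/-- On `{C_{o₁} = W}`, `s ∉ V̄(W)`: `s ↔ o` iff `s ↔ o` off `W̄`. [cite: VandenbergHaggstromKahn2005, §1 p. 8] -/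
theorem reachable_iff_sdiff_bar {ω W : Set (Sym2 V)} {o₁ s : V} (hW : openEdgeCluster ω o₁ = W)
    (hs : ¬ (s = o₁ ∨ ∃ e ∈ W, s ∈ e)) (o : V) :
    (openGraph ω).Reachable s o ↔
      (openGraph (ω \ {e | ∃ v ∈ e, v = o₁ ∨ ∃ e' ∈ W, v ∈ e'})).Reachable s o := by
  rw [reachable_iff_exists_mem_openEdgeCluster, reachable_iff_exists_mem_openEdgeCluster,
    openEdgeCluster_eq_sdiff_bar hW hs]

/-- On `{C_{o₁} = W}` with `s ∉ V̄(W)`: no vertex of `V̄(W)` is joined to `s`. [folklore] -/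
theorem not_reachable_of_mem_bar {ω W : Set (Sym2 V)} {o₁ s : V} (hW : openEdgeCluster ω o₁ = W)
    (hs : ¬ (s = o₁ ∨ ∃ e ∈ W, s ∈ e)) {o : V} (ho : o = o₁ ∨ ∃ e ∈ W, o ∈ e) :
    ¬ (openGraph ω).Reachable s o := fun h =>
  hs ((mem_bar_iff_reachable hW s).2 (((mem_bar_iff_reachable hW o).1 ho).trans h.symm))

/-- On `{C_{o₁} = W}`, `o₁ ∈ O`: `K_O = W ∪ ⋃_{o ∈ O'} C_o(ω ∖ W̄)`, `O' = {o ∈ O | o ∉ V̄(W)}`. [cite: VandenbergHaggstromKahn2005, §1 p. 8] -/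
theorem kUnion_eq {ω W : Set (Sym2 V)} {o₁ : V} (hW : openEdgeCluster ω o₁ = W) (O O' : Finset V)
    (ho₁ : o₁ ∈ O) (hO' : ∀ o, o ∈ O' ↔ o ∈ O ∧ ¬ (o = o₁ ∨ ∃ e ∈ W, o ∈ e)) :
    (⋃ o ∈ O, openEdgeCluster ω o) =
      W ∪ ⋃ o ∈ O', openEdgeCluster (ω \ {e | ∃ v ∈ e, v = o₁ ∨ ∃ e' ∈ W, v ∈ e'}) o := by
  ext e
  simp only [Set.mem_iUnion, Set.mem_union, exists_prop]
  constructor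
  · rintro ⟨o, hoO, he⟩
    by_cases hob : o = o₁ ∨ ∃ e ∈ W, o ∈ e
    · left
      rw [← hW, ← openEdgeCluster_eq_of_reachable ((mem_bar_iff_reachable hW o).1 hob)]
      exact he
    · right
      refine ⟨o, (hO' o).2 ⟨hoO, hob⟩, ?_⟩
      rw [← openEdgeCluster_eq_sdiff_bar hW hob]
      exact he
  · rintro (he | ⟨o, ho, he⟩)
    · exact ⟨o₁, ho₁, hW ▸ he⟩
    · refine ⟨o, ((hO' o).1 ho).1, ?_⟩
      rw [openEdgeCluster_eq_sdiff_bar hW ((hO' o).1 ho).2]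
      exact he

/-- On `{C_{o₁} = W}`, `s ∉ V̄(W)`: `s ↔ O` iff `s ↔ o` off `W̄` for some `o ∈ O'`. [cite: VandenbergHaggstromKahn2005, §1 p. 8] -/
theorem reachO_iff {ω W : Set (Sym2 V)} {o₁ s : V} (hW : openEdgeCluster ω o₁ = W) (O O' : Finset V)
    (hO' : ∀ o, o ∈ O' ↔ o ∈ O ∧ ¬ (o = o₁ ∨ ∃ e ∈ W, o ∈ e))
    (hs : ¬ (s = o₁ ∨ ∃ e ∈ W, s ∈ e)) :
    (∃ o ∈ O, (openGraph ω).Reachable s o) ↔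
      ∃ o ∈ O', (openGraph (ω \ {e | ∃ v ∈ e, v = o₁ ∨ ∃ e' ∈ W, v ∈ e'})).Reachable s o := by
  constructor
  · rintro ⟨o, hoO, hr⟩
    have hob : ¬ (o = o₁ ∨ ∃ e ∈ W, o ∈ e) := fun hob => not_reachable_of_mem_bar hW hs hob hr
    exact ⟨o, (hO' o).2 ⟨hoO, hob⟩, (reachable_iff_sdiff_bar hW hs o).1 hr⟩
  · rintro ⟨o, ho, hr⟩
    exact ⟨o, ((hO' o).1 ho).1, (reachable_iff_sdiff_bar hW hs o).2 hr⟩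

end Graph

section Sums

variable [Fintype V]

/-- **Conditioning on `C_s`, general integrand**: `E[Ψ(C_s, ω ∖ C̄_s)] = E_ω[E_η[Ψ(C_s(ω), η ∖ C̄_s(ω))]]`.
[cite: VandenbergHaggstromKahn2005, §1 pp. 7–8, display (10)] -/
theorem sum_cond_cluster_gen (w : Sym2 V → ℝ) (hm : ∑ ω, weight w ω = 1) (s : V)
    (Ψ : Set (Sym2 V) → Set (Sym2 V) → ℝ) :
    ∑ ω, weight w ω * Ψ (openEdgeCluster ω s)
        (ω \ {e | ∃ v ∈ e, v = s ∨ ∃ e' ∈ openEdgeCluster ω s, v ∈ e'}) =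
      ∑ ω, weight w ω * ∑ η, weight w η * Ψ (openEdgeCluster ω s)
        (η \ {e | ∃ v ∈ e, v = s ∨ ∃ e' ∈ openEdgeCluster ω s, v ∈ e'}) := by
  have key : ∀ W : Set (Sym2 V),
      ∑ ω, (if openEdgeCluster ω s = W then
          weight w ω * Ψ W (ω \ {e | ∃ v ∈ e, v = s ∨ ∃ e' ∈ W, v ∈ e'}) else 0) =
      ∑ ω, (if openEdgeCluster ω s = W then
          weight w ω * ∑ η, weight w η * Ψ W (η \ {e | ∃ v ∈ e, v = s ∨ ∃ e' ∈ W, v ∈ e'})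
        else 0) := by
    intro W
    set A : Set (Sym2 V) := {e | ∃ v ∈ e, v = s ∨ ∃ e' ∈ W, v ∈ e'} with hA
    set Φ : Set (Sym2 V) → Set (Sym2 V) → ℝ := fun ζ ξ =>
      if openEdgeCluster ζ s = W then Ψ W ξ else 0 with hΦ
    have h1 : ∀ ω, (if openEdgeCluster ω s = W then weight w ω * Ψ W (ω \ A) else 0) =
        weight w ω * Φ (ω ∩ A) (ω \ A) := by
      intro ω
      simp only [hΦ, hA, openEdgeCluster_inter_bar_eq_iff]
      split_ifs
      · rfl
      · rw [mul_zero]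
    have h2 : ∀ ω, weight w ω * ∑ ω', weight w ω' * Φ (ω ∩ A) (ω' \ A) =
        (if openEdgeCluster ω s = W then
          weight w ω * ∑ η, weight w η * Ψ W (η \ A) else 0) := by
      intro ω
      simp only [hΦ, hA, openEdgeCluster_inter_bar_eq_iff]
      split_ifs
      · rfl
      · simp
    calc ∑ ω, (if openEdgeCluster ω s = W then weight w ω * Ψ W (ω \ A) else 0)
        = (∑ ω, weight w ω) * ∑ ω, weight w ω * Φ (ω ∩ A) (ω \ A) := by
          rw [hm, one_mul]; exact Finset.sum_congr rfl fun ω _ => h1 ω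
      _ = ∑ ω, weight w ω * ∑ ω', weight w ω' * Φ (ω ∩ A) (ω' \ A) := blockFubini w A Φ
      _ = _ := Finset.sum_congr rfl fun ω _ => h2 ω
  calc ∑ ω, weight w ω * Ψ (openEdgeCluster ω s)
        (ω \ {e | ∃ v ∈ e, v = s ∨ ∃ e' ∈ openEdgeCluster ω s, v ∈ e'})
      = ∑ ω, ∑ W, (if openEdgeCluster ω s = W then
          weight w ω * Ψ W (ω \ {e | ∃ v ∈ e, v = s ∨ ∃ e' ∈ W, v ∈ e'}) else 0) :=
        Finset.sum_congr rfl fun ω _ => (Fintype.sum_ite_eq (openEdgeCluster ω s)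
          fun W => weight w ω * Ψ W (ω \ {e | ∃ v ∈ e, v = s ∨ ∃ e' ∈ W, v ∈ e'})).symm
    _ = ∑ W, ∑ ω, (if openEdgeCluster ω s = W then
          weight w ω * Ψ W (ω \ {e | ∃ v ∈ e, v = s ∨ ∃ e' ∈ W, v ∈ e'}) else 0) := Finset.sum_comm
    _ = ∑ W, ∑ ω, (if openEdgeCluster ω s = W then
          weight w ω * ∑ η, weight w η * Ψ W (η \ {e | ∃ v ∈ e, v = s ∨ ∃ e' ∈ W, v ∈ e'})
        else 0) := Finset.sum_congr rfl fun W _ => key W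
    _ = ∑ ω, ∑ W, (if openEdgeCluster ω s = W then
          weight w ω * ∑ η, weight w η * Ψ W (η \ {e | ∃ v ∈ e, v = s ∨ ∃ e' ∈ W, v ∈ e'})
        else 0) := Finset.sum_comm
    _ = _ := Finset.sum_congr rfl fun ω _ => Fintype.sum_ite_eq (openEdgeCluster ω s)
          fun W => weight w ω * ∑ η, weight w η *
            Ψ W (η \ {e | ∃ v ∈ e, v = s ∨ ∃ e' ∈ W, v ∈ e'})

/-- **The model with the pairs outside `A` switched off**, packaged: nonnegative weights at most one,
total mass one, and the marginalisation identity `E_w[Φ(ω ∩ A)] = E_{w_A}[Φ]`. [folklore] -/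
theorem restrict_model (w : Sym2 V → ℝ) (hw0 : ∀ e, 0 ≤ w e) (hw1 : ∀ e, w e ≤ 1)
    (hm : ∑ ω, weight w ω = 1) (A : Set (Sym2 V)) :
    ∃ wA : Sym2 V → ℝ, (∀ e, 0 ≤ wA e) ∧ (∀ e, wA e ≤ 1) ∧ ∑ ω, weight wA ω = 1 ∧
      ∀ Φ : Set (Sym2 V) → ℝ, ∑ ω, weight w ω * Φ (ω ∩ A) = ∑ ω, weight wA ω * Φ ω := by
  refine ⟨fun e => if e ∈ A then w e else 0, restrictWeight_nonneg hw0 A,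
    restrictWeight_le_one hw1 A, ?_, fun Φ => sum_weight_inter w hw0 hw1 A Φ⟩
  have := sum_weight_inter w hw0 hw1 A fun _ => (1 : ℝ)
  simp only [mul_one] at this
  rw [← this, hm]

/-- The integrand `F(C_s) 1{s ↮ O} (1 − h(K_O))` read through `(C_{o₁}, ω ∖ C̄_{o₁})`, `o₁ ∈ O`. [cite: VandenbergHaggstromKahn2005, §1 p. 8] -/
theorem integrand_eq (O O' : Finset V) {o₁ : V} (ho₁ : o₁ ∈ O) (s : V) (F h : Set (Sym2 V) → ℝ)
    {ω W : Set (Sym2 V)} (hW : openEdgeCluster ω o₁ = W)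
    (hO' : ∀ o, o ∈ O' ↔ o ∈ O ∧ ¬ (o = o₁ ∨ ∃ e ∈ W, o ∈ e)) :
    F (openEdgeCluster ω s) * ((1 - h (⋃ o ∈ O, openEdgeCluster ω o)) *
        ind {ξ : Set (Sym2 V) | ¬ ∃ o ∈ O, (openGraph ξ).Reachable s o} ω) =
      (if (s = o₁ ∨ ∃ e ∈ W, s ∈ e) then (0 : ℝ) else
          F (openEdgeCluster (ω \ {e | ∃ v ∈ e, v = o₁ ∨ ∃ e' ∈ W, v ∈ e'}) s) *
            ((1 - h (W ∪ ⋃ o ∈ O', openEdgeCluster (ω \ {e | ∃ v ∈ e, v = o₁ ∨ ∃ e' ∈ W, v ∈ e'}) o)) *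
              ind {ξ' : Set (Sym2 V) | ¬ ∃ o ∈ O',
                (openGraph ξ').Reachable s o} (ω \ {e | ∃ v ∈ e, v = o₁ ∨ ∃ e' ∈ W, v ∈ e'}))) := by
  by_cases hs : s = o₁ ∨ ∃ e ∈ W, s ∈ e
  · rw [if_pos hs]
    have hD : ω ∉ {ξ : Set (Sym2 V) | ¬ ∃ o ∈ O, (openGraph ξ).Reachable s o} := by
      simp only [Set.mem_setOf_eq, not_not]
      exact ⟨o₁, ho₁, ((mem_bar_iff_reachable hW s).1 hs).symm⟩
    rw [ind_of_not_mem hD]; ring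
  · rw [if_neg hs, ← openEdgeCluster_eq_sdiff_bar hW hs, ← kUnion_eq hW O O' ho₁ hO']
    congr 2
    by_cases hD : ω ∈ {ξ : Set (Sym2 V) | ¬ ∃ o ∈ O, (openGraph ξ).Reachable s o}
    · rw [ind_of_mem hD, ind_of_mem]
      simp only [Set.mem_setOf_eq] at hD ⊢
      exact fun h' => hD ((reachO_iff hW O O' hO' hs).2 h')
    · rw [ind_of_not_mem hD, ind_of_not_mem]
      simp only [Set.mem_setOf_eq, not_not] at hD ⊢
      exact (reachO_iff hW O O' hO' hs).1 hD

/-- **Lemma U for an observer set.**  For `F` increasing and `h ≤ 1`,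
`E[F(C_s)] · E[g₀] ≤ E[F(C_s) g₀]` with `g₀ = 1{s ↔ O} + 1{s ↮ O} h(K_O)`, `K_O = ⋃_{o∈O} C_o`.
Strong induction on `O` (condition on the cluster of one observer point; induction hypothesis in
the model with the pairs of `W̄` switched off; domination of `F`).  `O = {o}` is k41's `lemmaU`.
[cite: VandenbergHaggstromKahn2005, §1 p. 8 (coupling)] -/
theorem lemmaU_set (O : Finset V) :
    ∀ (w : Sym2 V → ℝ), (∀ e, 0 ≤ w e) → (∀ e, w e ≤ 1) → ∑ ω, weight w ω = 1 →
    ∀ (s : V) (F : Set (Sym2 V) → ℝ), Monotone F → ∀ (h : Set (Sym2 V) → ℝ), (∀ C, h C ≤ 1) →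
    (∑ ω, weight w ω * F (openEdgeCluster ω s)) *
        (∑ ω, weight w ω *
          (if ∃ o ∈ O, (openGraph ω).Reachable s o then (1 : ℝ)
            else h (⋃ o ∈ O, openEdgeCluster ω o))) ≤
      ∑ ω, weight w ω * (F (openEdgeCluster ω s) *
          (if ∃ o ∈ O, (openGraph ω).Reachable s o then (1 : ℝ)
            else h (⋃ o ∈ O, openEdgeCluster ω o))) := by
  induction O using Finset.strongInduction with
  | H O ih =>
  intro w hw0 hw1 hm s F hF h h1
  set g : Set (Sym2 V) → ℝ := fun ω =>
    if ∃ o ∈ O, (openGraph ω).Reachable s o then (1 : ℝ) else h (⋃ o ∈ O, openEdgeCluster ω o)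
    with hg
  show (∑ ω, weight w ω * F (openEdgeCluster ω s)) * (∑ ω, weight w ω * g ω) ≤
      ∑ ω, weight w ω * (F (openEdgeCluster ω s) * g ω)
  set D : Set (Set (Sym2 V)) := {ξ | ¬ ∃ o ∈ O, (openGraph ξ).Reachable s o} with hD
  set EF := ∑ ω, weight w ω * F (openEdgeCluster ω s) with hEF
  -- `g = 1 - k` with `k = (1 - h(K_O)) 1_D`
  set k : Set (Sym2 V) → ℝ := fun ω => (1 - h (⋃ o ∈ O, openEdgeCluster ω o)) * ind D ω with hk
  have hgk : ∀ ω, g ω = 1 - k ω := by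
    intro ω
    simp only [hk, hg]
    by_cases hr : ∃ o ∈ O, (openGraph ω).Reachable s o
    · rw [if_pos hr, ind_of_not_mem (show ω ∉ D from fun hω => hω hr)]; ring
    · rw [if_neg hr, ind_of_mem (show ω ∈ D from hr)]; ring
  -- the main estimate `E[F k] ≤ E[F] E[k]`
  have hFk : ∑ ω, weight w ω * (F (openEdgeCluster ω s) * k ω) ≤ EF * ∑ ω, weight w ω * k ω := by
    rcases O.eq_empty_or_nonempty with hOe | ⟨o₁, ho₁⟩
    · -- no observer point: `k` is the constant `1 - h ∅`
      have hkc : ∀ ω, k ω = 1 - h ∅ := by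
        intro ω
        simp only [hk, hD, hOe]
        rw [ind_of_mem]
        · simp
        · simp
      simp_rw [hkc]
      have t1 : ∑ x, weight w x * (F (openEdgeCluster x s) * (1 - h ∅)) = EF * (1 - h ∅) := by
        rw [hEF, Finset.sum_mul]
        exact Finset.sum_congr rfl fun _ _ => by ring
      have t2 : ∑ x, weight w x * (1 - h ∅) = 1 - h ∅ := by rw [← Finset.sum_mul, hm, one_mul]
      rw [t1, t2]
    · -- condition on `C_{o₁}`
      set Ψ : Set (Sym2 V) → Set (Sym2 V) → ℝ := fun W ξ =>
        if (s = o₁ ∨ ∃ e ∈ W, s ∈ e) then (0 : ℝ) else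
          F (openEdgeCluster ξ s) *
            ((1 - h (W ∪ ⋃ o ∈ O.filter (fun o => ¬ (o = o₁ ∨ ∃ e ∈ W, o ∈ e)), openEdgeCluster ξ o)) *
              ind {ξ' : Set (Sym2 V) | ¬ ∃ o ∈ O.filter (fun o => ¬ (o = o₁ ∨ ∃ e ∈ W, o ∈ e)),
                (openGraph ξ').Reachable s o} ξ) with hΨ
      set Ψ₁ : Set (Sym2 V) → Set (Sym2 V) → ℝ := fun W ξ =>
        if (s = o₁ ∨ ∃ e ∈ W, s ∈ e) then (0 : ℝ) else
          (fun _ => (1 : ℝ)) (openEdgeCluster ξ s) *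
            ((1 - h (W ∪ ⋃ o ∈ O.filter (fun o => ¬ (o = o₁ ∨ ∃ e ∈ W, o ∈ e)), openEdgeCluster ξ o)) *
              ind {ξ' : Set (Sym2 V) | ¬ ∃ o ∈ O.filter (fun o => ¬ (o = o₁ ∨ ∃ e ∈ W, o ∈ e)),
                (openGraph ξ').Reachable s o} ξ) with hΨ₁
      have hpt : ∀ ω, F (openEdgeCluster ω s) * k ω = Ψ (openEdgeCluster ω o₁)
          (ω \ {e | ∃ v ∈ e, v = o₁ ∨ ∃ e' ∈ openEdgeCluster ω o₁, v ∈ e'}) := fun ω => by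
        simp only [hΨ, hk]
        exact integrand_eq O _ ho₁ s F h rfl (fun o => by rw [Finset.mem_filter])
      have hpt₁ : ∀ ω, k ω = Ψ₁ (openEdgeCluster ω o₁)
          (ω \ {e | ∃ v ∈ e, v = o₁ ∨ ∃ e' ∈ openEdgeCluster ω o₁, v ∈ e'}) := fun ω => by
        have := integrand_eq O (O.filter (fun o => ¬ (o = o₁ ∨ ∃ e ∈ openEdgeCluster ω o₁, o ∈ e)))
          ho₁ s (fun _ => (1 : ℝ)) h (ω := ω) rfl (fun o => by rw [Finset.mem_filter])
        simp only [one_mul] at this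
        simp only [hΨ₁, hk, one_mul]
        exact this
      -- the inner inequality for a fixed value `W` of `C_{o₁}`
      have hinner : ∀ W : Set (Sym2 V),
          ∑ η, weight w η * Ψ W (η \ {e | ∃ v ∈ e, v = o₁ ∨ ∃ e' ∈ W, v ∈ e'}) ≤
            EF * ∑ η, weight w η * Ψ₁ W (η \ {e | ∃ v ∈ e, v = o₁ ∨ ∃ e' ∈ W, v ∈ e'}) := by
        intro W
        by_cases hs : s = o₁ ∨ ∃ e ∈ W, s ∈ e
        · simp only [hΨ, hΨ₁, if_pos hs, mul_zero, Finset.sum_const_zero]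
          exact le_rfl
        set B : Set (Sym2 V) := {e | ∃ v ∈ e, v = o₁ ∨ ∃ e' ∈ W, v ∈ e'} with hB
        set O' : Finset V := O.filter (fun o => ¬ (o = o₁ ∨ ∃ e ∈ W, o ∈ e)) with hO'
        have hO'O : O' ⊂ O := by
          refine Finset.ssubset_iff_subset_ne.2 ⟨Finset.filter_subset _ _, fun heq => ?_⟩
          have : o₁ ∈ O' := heq ▸ ho₁
          exact (Finset.mem_filter.1 this).2 (Or.inl rfl)
        set h' : Set (Sym2 V) → ℝ := fun K => h (W ∪ K) with hh'
        have h1' : ∀ K, h' K ≤ 1 := fun K => h1 _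
        set k' : Set (Sym2 V) → ℝ := fun ξ => (1 - h' (⋃ o ∈ O', openEdgeCluster ξ o)) *
          ind {ξ' : Set (Sym2 V) | ¬ ∃ o ∈ O', (openGraph ξ').Reachable s o} ξ with hk'
        have hgk' : ∀ ξ, (if ∃ o ∈ O', (openGraph ξ).Reachable s o then (1 : ℝ)
            else h' (⋃ o ∈ O', openEdgeCluster ξ o)) = 1 - k' ξ := by
          intro ξ
          simp only [hk']
          by_cases hr : ∃ o ∈ O', (openGraph ξ).Reachable s o
          · rw [if_pos hr, ind_of_not_mem]
            · ring
            · simpa only [Set.mem_setOf_eq, not_not] using hr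
          · rw [if_neg hr, ind_of_mem]
            · ring
            · simpa only [Set.mem_setOf_eq] using hr
        have hΨk : ∀ ξ, Ψ W ξ = F (openEdgeCluster ξ s) * k' ξ := fun ξ => by
          simp only [hΨ, if_neg hs, hk', hh', hO']
        have hΨ₁k : ∀ ξ, Ψ₁ W ξ = k' ξ := fun ξ => by
          simp only [hΨ₁, if_neg hs, hk', hh', hO', one_mul]
        simp_rw [hΨk, hΨ₁k]
        -- pass to the model with the pairs of `B` switched off
        obtain ⟨wA, hwA0, hwA1, hmA, htr⟩ := restrict_model w hw0 hw1 hm Bᶜ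
        have hsd : ∀ η : Set (Sym2 V), η \ B = η ∩ Bᶜ := fun η => Set.sdiff_eq η B
        simp_rw [hsd]
        rw [htr (fun η => F (openEdgeCluster η s) * k' η), htr k']
        set EF' := ∑ η, weight wA η * F (openEdgeCluster η s) with hEF'
        set EK' := ∑ η, weight wA η * k' η with hEK'
        -- the induction hypothesis in the restricted model, in product form
        have IH := ih O' hO'O wA hwA0 hwA1 hmA s F hF h' h1'
        have x1 : ∑ η, weight wA η * (if ∃ o ∈ O', (openGraph η).Reachable s o then (1 : ℝ)
            else h' (⋃ o ∈ O', openEdgeCluster η o)) = 1 - EK' := by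
          have := sum_affine wA (fun η => if ∃ o ∈ O', (openGraph η).Reachable s o then (1 : ℝ)
            else h' (⋃ o ∈ O', openEdgeCluster η o)) (fun _ => 1) k' k' k' 1 (-1) 0 0
            (fun η => by rw [hgk']; ring)
          rw [this]; simp [hmA]; ring
        have x2 : ∑ η, weight wA η * (F (openEdgeCluster η s) *
            (if ∃ o ∈ O', (openGraph η).Reachable s o then (1 : ℝ)
              else h' (⋃ o ∈ O', openEdgeCluster η o))) =
            EF' - ∑ η, weight wA η * (F (openEdgeCluster η s) * k' η) := by
          have := sum_affine wA (fun η => F (openEdgeCluster η s) *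
            (if ∃ o ∈ O', (openGraph η).Reachable s o then (1 : ℝ)
              else h' (⋃ o ∈ O', openEdgeCluster η o)))
            (fun η => F (openEdgeCluster η s)) (fun η => F (openEdgeCluster η s) * k' η) k' k'
            1 (-1) 0 0 (fun η => by rw [hgk']; ring)
          rw [this]; simp [hEF']; ring
        rw [x1, x2] at IH
        have hFk' : ∑ η, weight wA η * (F (openEdgeCluster η s) * k' η) ≤ EF' * EK' := by
          nlinarith [IH]
        -- domination `E'[F] ≤ E[F]` and `0 ≤ E'[k']`
        have hdom : EF' ≤ EF := by
          rw [hEF', ← htr (fun η => F (openEdgeCluster η s)), hEF]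
          exact Finset.sum_le_sum fun η _ => mul_le_mul_of_nonneg_left
            (hF (openEdgeCluster_mono Set.inter_subset_left s)) (weight_nonneg hw0 hw1 η)
        have hk'0 : ∀ ξ, 0 ≤ k' ξ := fun ξ =>
          mul_nonneg (sub_nonneg.2 (h1' _)) (ind_nonneg _ _)
        have hEK'0 : 0 ≤ EK' :=
          Finset.sum_nonneg fun η _ => mul_nonneg (weight_nonneg hwA0 hwA1 η) (hk'0 η)
        exact hFk'.trans (mul_le_mul_of_nonneg_right hdom hEK'0)
      -- assemble with the conditioning identity
      calc ∑ ω, weight w ω * (F (openEdgeCluster ω s) * k ω)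
          = ∑ ω, weight w ω * Ψ (openEdgeCluster ω o₁)
              (ω \ {e | ∃ v ∈ e, v = o₁ ∨ ∃ e' ∈ openEdgeCluster ω o₁, v ∈ e'}) :=
            Finset.sum_congr rfl fun ω _ => by rw [hpt ω]
        _ = ∑ ω, weight w ω * ∑ η, weight w η * Ψ (openEdgeCluster ω o₁)
              (η \ {e | ∃ v ∈ e, v = o₁ ∨ ∃ e' ∈ openEdgeCluster ω o₁, v ∈ e'}) :=
            sum_cond_cluster_gen w hm o₁ Ψ
        _ ≤ ∑ ω, weight w ω * (EF * ∑ η, weight w η * Ψ₁ (openEdgeCluster ω o₁)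
              (η \ {e | ∃ v ∈ e, v = o₁ ∨ ∃ e' ∈ openEdgeCluster ω o₁, v ∈ e'})) :=
            Finset.sum_le_sum fun ω _ => mul_le_mul_of_nonneg_left (hinner _) (weight_nonneg hw0 hw1 ω)
        _ = EF * ∑ ω, weight w ω * ∑ η, weight w η * Ψ₁ (openEdgeCluster ω o₁)
              (η \ {e | ∃ v ∈ e, v = o₁ ∨ ∃ e' ∈ openEdgeCluster ω o₁, v ∈ e'}) := by
            rw [Finset.mul_sum]
            exact Finset.sum_congr rfl fun ω _ => by ring
        _ = EF * ∑ ω, weight w ω * Ψ₁ (openEdgeCluster ω o₁)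
              (ω \ {e | ∃ v ∈ e, v = o₁ ∨ ∃ e' ∈ openEdgeCluster ω o₁, v ∈ e'}) := by
            rw [sum_cond_cluster_gen w hm o₁ Ψ₁]
        _ = EF * ∑ ω, weight w ω * k ω := by
            congr 1
            exact Finset.sum_congr rfl fun ω _ => by rw [hpt₁ ω]
  -- assemble (as in Lemma U)
  have e3 : ∑ ω, weight w ω * g ω = 1 - ∑ ω, weight w ω * k ω := by
    have := sum_affine w g (fun _ => 1) k k k 1 (-1) 0 0 (fun ω => by rw [hgk]; ring)
    rw [this]; simp [hm]; ring
  have e4 : ∑ ω, weight w ω * (F (openEdgeCluster ω s) * g ω) =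
      EF - ∑ ω, weight w ω * (F (openEdgeCluster ω s) * k ω) := by
    have := sum_affine w (fun ω => F (openEdgeCluster ω s) * g ω)
      (fun ω => F (openEdgeCluster ω s)) (fun ω => F (openEdgeCluster ω s) * k ω) k k 1 (-1) 0 0
      (fun ω => by rw [hgk]; ring)
    rw [this]; simp [hEF]; ring
  rw [e3, e4]
  nlinarith [hFk]

end Sums

end SandwichSet

open scoped Classical in
open SandwichSet in
/-- **Registered stub `stub_lemmaUSet_sp`** (= `SandwichSet.lemmaU_set` on `Fin n`): Lemma U for an
observer SET, `E[F(C_s)] · E[g₀] ≤ E[F(C_s) g₀]` with `g₀ = 1{s ↔ O} + 1{s ↮ O} h(K_O)`, `F` increasing,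
`h ≤ 1`. [cite: VandenbergHaggstromKahn2005, §1 p. 8 (coupling)] -/
theorem stub_lemmaUSet_sp : ∀ (n : ℕ) (O : Finset (Fin n)) (w : Sym2 (Fin n) → ℝ), (∀ e, 0 ≤ w e) → (∀ e, w e ≤ 1) → ∑ ω, BHK2006.weight w ω = 1 → ∀ (s : Fin n) (F : Set (Sym2 (Fin n)) → ℝ), Monotone F → ∀ (h : Set (Sym2 (Fin n)) → ℝ), (∀ C, h C ≤ 1) → (∑ ω, BHK2006.weight w ω * F (openEdgeCluster ω s)) * (∑ ω, BHK2006.weight w ω * (if ∃ o ∈ O, (openGraph ω).Reachable s o then (1 : ℝ) else h (⋃ o ∈ O, openEdgeCluster ω o))) ≤ ∑ ω, BHK2006.weight w ω * (F (openEdgeCluster ω s) * (if ∃ o ∈ O, (openGraph ω).Reachable s o then (1 : ℝ) else h (⋃ o ∈ O, openEdgeCluster ω o))) :=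
  fun _ O w hw0 hw1 hm s F hF h h1 => by convert lemmaU_set O w hw0 hw1 hm s F hF h h1 using 6

end Summit.CriticalPhenomena.PercolationContinuityZ3.Theorems
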